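import Summits.KontsevichZagierPeriods.Zeta5Search.Barrier.ConeGammaCuspPairGauge

/-!
# ζ(5) search — BARRIER: THE WALL-WEIGHTED OFF-CHAMBER BOUND — each inverted wall pays its own defect times its gap

HONEST FRAMING (cell `pub-zeta5`): systematic search; no irrationality claim unless kernel-certified. MODEL objects
under Brown–Zudilin's (28)+(30) accounting ([BZ22] = arXiv:2210.03391; (28) observed, not proved); nothing here is a
statement about `ζ(5)`, any `γ` of record, the cone's supremum (C2 OPEN) or the value / sign of the cusp slope, of any
wall defect bound or gauge at a named direction (DATA of the cell); S-E stays CONJECTURED; records in print UNMOVED.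
Prover P2 g32, item «THE WALL-WEIGHTED GAUGE» (INBOX 2026-08-27), file (2): P2 g31's off-chamber error bound
(`ConeGammaCuspPeriodGauge`, ONE defect bound `Λ_F` for all 378 walls) sharpened wall by wall, in CLOSED FORM.

SETTING (as `cuspSlope_eq_lovasz_period`): all 28 forms of `a` positive, `T > 0` a period, junction data `M m`, `f m`
(`hf`), the period pattern function `F(A) = Σ_m f m (A ∩ M m)` (`hF`), rates `r_k(δ) = φ_k(δ)/h_k(a)`, a GENERIC reference
`δ₀` (rates `ρ₀` pairwise distinct) with its chamber functional `G_{δ₀}(δ) = Σ_k (F(P≤(k)) − F(P<(k)))·r_k(δ)`, and PER-WALL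
DEFECT BOUNDS: `Λ k l ≥` every defect `F(S+k) + F(S+l) − F(S) − F(S+k+l)` (upper side) or `≥` minus every defect (lower
side), behind every prefix `S` — hypotheses `hdef`, one number per wall instead of one number for the period.
* **`cuspSlope_le_greedy_add_wallGauge`** — `σ(δ) ≤ G_{δ₀}(δ) + Σ_{ρ₀ k < ρ₀ l} Λ k l · max(r_k(δ) − r_l(δ), 0)`: off its
  chamber a chamber functional under-predicts the cusp slope by at most the sum, over the walls INVERTED between `δ₀` and
  `δ` (`k` before `l` for `δ₀`, after for `δ`), of (that wall's defect bound) × (its rate gap at `δ`) — the DC trick of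
  P2 g31's file (7) with the WEIGHTED pair function `q(A) = −Σ_{k,l∈A} Λ k l` of file (1) in place of `−C(|A|,2)`, Edmonds'
  bound for the supermodular `F − q`, and `pairGauge_closed_form`; no chain in the statement (`exists_flip_chain` inside);
* **`greedy_sub_wallGauge_le_cuspSlope`** — the lower side with `−Λ k l ≤` every defect (`F + q` submodular);
* `cuspSlope_le_greedy_add_gauge_closed` / `greedy_sub_gauge_closed_le_cuspSlope` — P2 g31's two bounds (one `Λ` for all
  walls) in closed form: `|σ(δ) − G_{δ₀}(δ)| ≤ Λ · Σ_{inverted walls} |r_k(δ) − r_l(δ)|`;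
* `wallGauge_eq_zero_of_refines`, **`exists_generic_wallBound_eq_cuspSlope`** — on the closed chamber of `δ₀` the gauge term
  vanishes and both bounds are the identity of file (1) of P2 g31; so for EVERY `δ` some generic reference predicts `σ(δ)`
  exactly with zero gauge (pointwise completeness of the wall-weighted certificate; file (3) turns it into finite CONE
  certificates).
DESK (DATA, `HOME/pub-zeta5-p2/g32/alg/wallgauge.py`, exact rationals on P2 g11's sealed machinery; per-wall bounds SAMPLED
over random prefixes, hence lower estimates of the true suprema): the weighted gauge is 0.7–9 % of P2 g31's global one on
random pairs (record / flag / argmax-120 / t*: median 7.5 / 6.2 / 3.4 / 0.75 %), 0 bound violations. NOT here: any `Λ`,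
gauge or `σ` at a named direction; `γ`, C2, S-E, `ζ(5)`.
-/

noncomputable section

open Set MeasureTheory Finset
open scoped Topology

namespace Summit.KontsevichZagierPeriods.Zeta5Search.Barrier.ConeGamma

/-! ### The wall-weighted off-chamber bounds -/

/-- **THE WALL-WEIGHTED OFF-CHAMBER BOUND, UPPER SIDE.** With the data of `cuspSlope_eq_lovasz_period`, a generic
reference `δ₀` and per-wall bounds `Λ k l ≥` every defect of `F` at the wall `{k,l}` behind every prefix: for EVERY `δ`,
`cuspSlope a T δ ≤ Σ_k (F(P≤(k)) − F(P<(k)))·r_k(δ) + Σ_{ρ₀ k < ρ₀ l} Λ k l · max(r_k(δ) − r_l(δ), 0)`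
(`r_k = φ_k/h_k(a)`, `ρ₀ = r(δ₀)`): only the walls inverted between `δ₀` and `δ` contribute, each its own defect bound times
its rate gap. -/
theorem cuspSlope_le_greedy_add_wallGauge {a : Dir} (hpos : ∀ k, 0 < h28 a k) {T : ℝ} (hT : 0 < T)
    (hper : ∀ k : Fin 28, ∃ z : ℤ, T * h28 a k = z)
    {M : ℕ → Finset (Fin 28)} {f : ℕ → Finset (Fin 28) → ℝ}
    (hf : ∀ m, m + 1 < (bkpts a T).card → ∀ Δ : Fin 8 → ℝ, (∀ k, |phiForm Δ k| < 1) →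
      (∀ k, |phiForm Δ k| < wallDist a T) →
        (torusN (bkpt a T m • sParam a + Δ) : ℝ) = f m ((M m).filter fun k => 0 ≤ phiForm Δ k))
    {F : Finset (Fin 28) → ℝ} (hF : ∀ A, F A = ∑ m ∈ Finset.range ((bkpts a T).card - 1), f m (A ∩ M m))
    {Λ : Fin 28 → Fin 28 → ℝ}
    (hdef : ∀ S : Finset (Fin 28), ∀ k l : Fin 28, k ∉ S → l ∉ S → k ≠ l →
      F (insert k S) + F (insert l S) - F S - F (insert k (insert l S)) ≤ Λ k l)
    {δ₀ : Fin 8 → ℝ} (hgen : ∀ k l : Fin 28, k ≠ l → phiForm δ₀ k / h28 a k ≠ phiForm δ₀ l / h28 a l)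
    (δ : Fin 8 → ℝ) :
    cuspSlope a T δ ≤
      ∑ k, (F (Finset.univ.filter fun l => phiForm δ₀ k / h28 a k ≤ phiForm δ₀ l / h28 a l) -
          F (Finset.univ.filter fun l => phiForm δ₀ k / h28 a k < phiForm δ₀ l / h28 a l)) *
        (phiForm δ k / h28 a k) +
      ∑ k, ∑ l, if phiForm δ₀ k / h28 a k < phiForm δ₀ l / h28 a l then
        Λ k l * max (phiForm δ k / h28 a k - phiForm δ l / h28 a l) 0 else 0 := by
  classical
  obtain ⟨ρ, hρ⟩ : ∃ ρ : Fin 28 → ℝ, ∀ k, ρ k = phiForm δ₀ k / h28 a k := ⟨_, fun _ => rfl⟩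
  obtain ⟨r, hr⟩ : ∃ r : Fin 28 → ℝ, ∀ k, r k = phiForm δ k / h28 a k := ⟨_, fun _ => rfl⟩
  simp only [← hρ, ← hr] at hgen ⊢
  obtain ⟨n, d, hd0, hdn, hmono, hflip⟩ := exists_flip_chain hpos δ
  simp only [← hr] at hflip
  have hflip' : ∀ k, ∃ i ≤ n, d i = -(phiForm δ k / h28 a k) := fun k => by
    obtain ⟨i, -, hin, hdi⟩ := hflip k; exact ⟨i, hin.le, by rw [hdi, hr]⟩
  have hσ := cuspSlope_eq_lovasz_period hpos hT hper hf hF δ hd0 hdn (fun j hj => (hmono j hj).le) hflip'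
  simp only [← hr] at hσ
  -- the weighted pair function of the reference order
  obtain ⟨q, hq⟩ : ∃ q : Finset (Fin 28) → ℝ, ∀ A, q A = -∑ k ∈ A, ∑ l ∈ A, if ρ k < ρ l then Λ k l else 0 :=
    ⟨_, fun _ => rfl⟩
  -- `F − q` is supermodular: its local defects are `m_F − Λ ≤ 0`
  have hsup : ∀ A B : Finset (Fin 28), A ⊆ Finset.univ → B ⊆ Finset.univ →
      (F A - q A) + (F B - q B) ≤ (F (A ∪ B) - q (A ∪ B)) + (F (A ∩ B) - q (A ∩ B)) :=
    supermodular_of_local_nonpos (M := Finset.univ) (f := fun X => F X - q X)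
      fun S _ k _ l _ hkS hlS hkl => by
        have hq' := pairFun_local_defect hq hkS hlS hkl
        rcases lt_or_gt_of_ne (hgen k l hkl) with h | h
        · have h1 := hdef S k l hkS hlS hkl
          rw [if_pos h, if_neg (not_lt.mpr h.le), add_zero] at hq'
          linarith
        · have h1 := hdef S l k hlS hkS hkl.symm
          rw [Finset.insert_comm] at h1
          rw [if_neg (not_lt.mpr h.le), if_pos h, zero_add] at hq'
          linarith
  have key := lovasz_le_greedy_of_supermodular (M := Finset.univ) (ρ := ρ) (f := fun X => F X - q X)
    (fun k _ l _ hkl => hgen k l hkl) hsup (fun k => -r k) hmono (fun k _ => hflip k)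
  simp only [neg_neg] at key
  have hgauge := pairGauge_closed_form hq hgen (fun k => -r k) hmono hflip
  simp only [neg_neg, neg_sub_neg] at hgauge
  -- split the two sides of `key` into their `F`- and `q`-parts
  have eL : ∑ k, (F (Finset.univ.filter fun l => ρ k ≤ ρ l) - q (Finset.univ.filter fun l => ρ k ≤ ρ l) -
        (F (Finset.univ.filter fun l => ρ k < ρ l) - q (Finset.univ.filter fun l => ρ k < ρ l))) * r k =
      ∑ k, (F (Finset.univ.filter fun l => ρ k ≤ ρ l) - F (Finset.univ.filter fun l => ρ k < ρ l)) * r k -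
        ∑ k, (q (Finset.univ.filter fun l => ρ k ≤ ρ l) - q (Finset.univ.filter fun l => ρ k < ρ l)) * r k := by
    rw [← Finset.sum_sub_distrib]
    exact Finset.sum_congr rfl fun k _ => by ring
  have eR : ∑ i ∈ Finset.Ico 1 n, d i *
        (F (Finset.univ.filter fun k => -r k ≤ d i) - q (Finset.univ.filter fun k => -r k ≤ d i) -
          (F (Finset.univ.filter fun k => -r k ≤ d (i - 1)) - q (Finset.univ.filter fun k => -r k ≤ d (i - 1)))) =
      ∑ i ∈ Finset.Ico 1 n, d i *
          (F (Finset.univ.filter fun k => -r k ≤ d i) - F (Finset.univ.filter fun k => -r k ≤ d (i - 1))) -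
        ∑ i ∈ Finset.Ico 1 n, d i *
          (q (Finset.univ.filter fun k => -r k ≤ d i) - q (Finset.univ.filter fun k => -r k ≤ d (i - 1))) := by
    rw [← Finset.sum_sub_distrib]
    exact Finset.sum_congr rfl fun i _ => by ring
  rw [eL, eR] at key
  rw [hσ]
  linarith

/-- **THE WALL-WEIGHTED OFF-CHAMBER BOUND, LOWER SIDE.** Under the same data with `−Λ k l ≤` every defect of `F` at the
wall `{k,l}`: `Σ_k (F(P≤(k)) − F(P<(k)))·r_k(δ) − Σ_{ρ₀ k < ρ₀ l} Λ k l · max(r_k(δ) − r_l(δ), 0) ≤ cuspSlope a T δ`. -/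
theorem greedy_sub_wallGauge_le_cuspSlope {a : Dir} (hpos : ∀ k, 0 < h28 a k) {T : ℝ} (hT : 0 < T)
    (hper : ∀ k : Fin 28, ∃ z : ℤ, T * h28 a k = z)
    {M : ℕ → Finset (Fin 28)} {f : ℕ → Finset (Fin 28) → ℝ}
    (hf : ∀ m, m + 1 < (bkpts a T).card → ∀ Δ : Fin 8 → ℝ, (∀ k, |phiForm Δ k| < 1) →
      (∀ k, |phiForm Δ k| < wallDist a T) →
        (torusN (bkpt a T m • sParam a + Δ) : ℝ) = f m ((M m).filter fun k => 0 ≤ phiForm Δ k))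
    {F : Finset (Fin 28) → ℝ} (hF : ∀ A, F A = ∑ m ∈ Finset.range ((bkpts a T).card - 1), f m (A ∩ M m))
    {Λ : Fin 28 → Fin 28 → ℝ}
    (hdef : ∀ S : Finset (Fin 28), ∀ k l : Fin 28, k ∉ S → l ∉ S → k ≠ l →
      -Λ k l ≤ F (insert k S) + F (insert l S) - F S - F (insert k (insert l S)))
    {δ₀ : Fin 8 → ℝ} (hgen : ∀ k l : Fin 28, k ≠ l → phiForm δ₀ k / h28 a k ≠ phiForm δ₀ l / h28 a l)
    (δ : Fin 8 → ℝ) :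
    ∑ k, (F (Finset.univ.filter fun l => phiForm δ₀ k / h28 a k ≤ phiForm δ₀ l / h28 a l) -
          F (Finset.univ.filter fun l => phiForm δ₀ k / h28 a k < phiForm δ₀ l / h28 a l)) *
        (phiForm δ k / h28 a k) -
      ∑ k, ∑ l, (if phiForm δ₀ k / h28 a k < phiForm δ₀ l / h28 a l then
        Λ k l * max (phiForm δ k / h28 a k - phiForm δ l / h28 a l) 0 else 0) ≤
      cuspSlope a T δ := by
  classical
  obtain ⟨ρ, hρ⟩ : ∃ ρ : Fin 28 → ℝ, ∀ k, ρ k = phiForm δ₀ k / h28 a k := ⟨_, fun _ => rfl⟩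
  obtain ⟨r, hr⟩ : ∃ r : Fin 28 → ℝ, ∀ k, r k = phiForm δ k / h28 a k := ⟨_, fun _ => rfl⟩
  simp only [← hρ, ← hr] at hgen ⊢
  obtain ⟨n, d, hd0, hdn, hmono, hflip⟩ := exists_flip_chain hpos δ
  simp only [← hr] at hflip
  have hflip' : ∀ k, ∃ i ≤ n, d i = -(phiForm δ k / h28 a k) := fun k => by
    obtain ⟨i, -, hin, hdi⟩ := hflip k; exact ⟨i, hin.le, by rw [hdi, hr]⟩
  have hσ := cuspSlope_eq_lovasz_period hpos hT hper hf hF δ hd0 hdn (fun j hj => (hmono j hj).le) hflip'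
  simp only [← hr] at hσ
  obtain ⟨q, hq⟩ : ∃ q : Finset (Fin 28) → ℝ, ∀ A, q A = -∑ k ∈ A, ∑ l ∈ A, if ρ k < ρ l then Λ k l else 0 :=
    ⟨_, fun _ => rfl⟩
  -- `F + q` is submodular: its local defects are `m_F + Λ ≥ 0`
  have hsub : ∀ A B : Finset (Fin 28), A ⊆ Finset.univ → B ⊆ Finset.univ →
      (F (A ∪ B) + q (A ∪ B)) + (F (A ∩ B) + q (A ∩ B)) ≤ (F A + q A) + (F B + q B) :=
    submodular_of_local_nonneg (M := Finset.univ) (f := fun X => F X + q X)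
      fun S _ k _ l _ hkS hlS hkl => by
        have hq' := pairFun_local_defect hq hkS hlS hkl
        rcases lt_or_gt_of_ne (hgen k l hkl) with h | h
        · have h1 := hdef S k l hkS hlS hkl
          rw [if_pos h, if_neg (not_lt.mpr h.le), add_zero] at hq'
          linarith
        · have h1 := hdef S l k hlS hkS hkl.symm
          rw [Finset.insert_comm] at h1
          rw [if_neg (not_lt.mpr h.le), if_pos h, zero_add] at hq'
          linarith
  have key := greedy_le_lovasz_of_submodular (M := Finset.univ) (ρ := ρ) (f := fun X => F X + q X)
    (fun k _ l _ hkl => hgen k l hkl) hsub (fun k => -r k) hmono (fun k _ => hflip k)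
  simp only [neg_neg] at key
  have hgauge := pairGauge_closed_form hq hgen (fun k => -r k) hmono hflip
  simp only [neg_neg, neg_sub_neg] at hgauge
  have eL : ∑ k, (F (Finset.univ.filter fun l => ρ k ≤ ρ l) + q (Finset.univ.filter fun l => ρ k ≤ ρ l) -
        (F (Finset.univ.filter fun l => ρ k < ρ l) + q (Finset.univ.filter fun l => ρ k < ρ l))) * r k =
      ∑ k, (F (Finset.univ.filter fun l => ρ k ≤ ρ l) - F (Finset.univ.filter fun l => ρ k < ρ l)) * r k +
        ∑ k, (q (Finset.univ.filter fun l => ρ k ≤ ρ l) - q (Finset.univ.filter fun l => ρ k < ρ l)) * r k := by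
    rw [← Finset.sum_add_distrib]
    exact Finset.sum_congr rfl fun k _ => by ring
  have eR : ∑ i ∈ Finset.Ico 1 n, d i *
        (F (Finset.univ.filter fun k => -r k ≤ d i) + q (Finset.univ.filter fun k => -r k ≤ d i) -
          (F (Finset.univ.filter fun k => -r k ≤ d (i - 1)) + q (Finset.univ.filter fun k => -r k ≤ d (i - 1)))) =
      ∑ i ∈ Finset.Ico 1 n, d i *
          (F (Finset.univ.filter fun k => -r k ≤ d i) - F (Finset.univ.filter fun k => -r k ≤ d (i - 1))) +
        ∑ i ∈ Finset.Ico 1 n, d i *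
          (q (Finset.univ.filter fun k => -r k ≤ d i) - q (Finset.univ.filter fun k => -r k ≤ d (i - 1))) := by
    rw [← Finset.sum_add_distrib]
    exact Finset.sum_congr rfl fun i _ => by ring
  rw [eL, eR] at key
  rw [hσ]
  linarith

/-! ### One bound for all walls: P2 g31's gauge bound in closed form -/

/-- **P2 g31's UPPER BOUND IN CLOSED FORM**: with ONE bound `Λ ≥` every wall defect,
`cuspSlope a T δ ≤ G_{δ₀}(δ) + Λ · Σ_{ρ₀ k < ρ₀ l} max(r_k(δ) − r_l(δ), 0)` — `Λ` times the total rate gap of the walls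
inverted between `δ₀` and `δ` (the universal gauge of `cuspSlope_le_greedy_add_gauge`, by `gauge_closed_form`). -/
theorem cuspSlope_le_greedy_add_gauge_closed {a : Dir} (hpos : ∀ k, 0 < h28 a k) {T : ℝ} (hT : 0 < T)
    (hper : ∀ k : Fin 28, ∃ z : ℤ, T * h28 a k = z)
    {M : ℕ → Finset (Fin 28)} {f : ℕ → Finset (Fin 28) → ℝ}
    (hf : ∀ m, m + 1 < (bkpts a T).card → ∀ Δ : Fin 8 → ℝ, (∀ k, |phiForm Δ k| < 1) →
      (∀ k, |phiForm Δ k| < wallDist a T) →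
        (torusN (bkpt a T m • sParam a + Δ) : ℝ) = f m ((M m).filter fun k => 0 ≤ phiForm Δ k))
    {F : Finset (Fin 28) → ℝ} (hF : ∀ A, F A = ∑ m ∈ Finset.range ((bkpts a T).card - 1), f m (A ∩ M m))
    {Λ : ℝ}
    (hdef : ∀ S : Finset (Fin 28), ∀ k l : Fin 28, k ∉ S → l ∉ S → k ≠ l →
      F (insert k S) + F (insert l S) - F S - F (insert k (insert l S)) ≤ Λ)
    {δ₀ : Fin 8 → ℝ} (hgen : ∀ k l : Fin 28, k ≠ l → phiForm δ₀ k / h28 a k ≠ phiForm δ₀ l / h28 a l)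
    (δ : Fin 8 → ℝ) :
    cuspSlope a T δ ≤
      ∑ k, (F (Finset.univ.filter fun l => phiForm δ₀ k / h28 a k ≤ phiForm δ₀ l / h28 a l) -
          F (Finset.univ.filter fun l => phiForm δ₀ k / h28 a k < phiForm δ₀ l / h28 a l)) *
        (phiForm δ k / h28 a k) +
      Λ * ∑ k, ∑ l, if phiForm δ₀ k / h28 a k < phiForm δ₀ l / h28 a l then
        max (phiForm δ k / h28 a k - phiForm δ l / h28 a l) 0 else 0 := by
  have h := cuspSlope_le_greedy_add_wallGauge hpos hT hper hf hF (Λ := fun _ _ => Λ)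
    (fun S k l hkS hlS hkl => hdef S k l hkS hlS hkl) hgen δ
  have e : ∑ k, ∑ l, (if phiForm δ₀ k / h28 a k < phiForm δ₀ l / h28 a l then
      (fun _ _ : Fin 28 => Λ) k l * max (phiForm δ k / h28 a k - phiForm δ l / h28 a l) 0 else 0) =
      Λ * ∑ k, ∑ l, if phiForm δ₀ k / h28 a k < phiForm δ₀ l / h28 a l then
        max (phiForm δ k / h28 a k - phiForm δ l / h28 a l) 0 else 0 := by
    rw [Finset.mul_sum]
    refine Finset.sum_congr rfl fun k _ => ?_
    rw [Finset.mul_sum]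
    refine Finset.sum_congr rfl fun l _ => ?_
    by_cases hkl : phiForm δ₀ k / h28 a k < phiForm δ₀ l / h28 a l
    · rw [if_pos hkl, if_pos hkl]
    · rw [if_neg hkl, if_neg hkl, mul_zero]
  linarith [e]

/-- **P2 g31's LOWER BOUND IN CLOSED FORM**: with `−Λ ≤` every wall defect,
`G_{δ₀}(δ) − Λ · Σ_{ρ₀ k < ρ₀ l} max(r_k(δ) − r_l(δ), 0) ≤ cuspSlope a T δ`. -/
theorem greedy_sub_gauge_closed_le_cuspSlope {a : Dir} (hpos : ∀ k, 0 < h28 a k) {T : ℝ} (hT : 0 < T)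
    (hper : ∀ k : Fin 28, ∃ z : ℤ, T * h28 a k = z)
    {M : ℕ → Finset (Fin 28)} {f : ℕ → Finset (Fin 28) → ℝ}
    (hf : ∀ m, m + 1 < (bkpts a T).card → ∀ Δ : Fin 8 → ℝ, (∀ k, |phiForm Δ k| < 1) →
      (∀ k, |phiForm Δ k| < wallDist a T) →
        (torusN (bkpt a T m • sParam a + Δ) : ℝ) = f m ((M m).filter fun k => 0 ≤ phiForm Δ k))
    {F : Finset (Fin 28) → ℝ} (hF : ∀ A, F A = ∑ m ∈ Finset.range ((bkpts a T).card - 1), f m (A ∩ M m))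
    {Λ : ℝ}
    (hdef : ∀ S : Finset (Fin 28), ∀ k l : Fin 28, k ∉ S → l ∉ S → k ≠ l →
      -Λ ≤ F (insert k S) + F (insert l S) - F S - F (insert k (insert l S)))
    {δ₀ : Fin 8 → ℝ} (hgen : ∀ k l : Fin 28, k ≠ l → phiForm δ₀ k / h28 a k ≠ phiForm δ₀ l / h28 a l)
    (δ : Fin 8 → ℝ) :
    ∑ k, (F (Finset.univ.filter fun l => phiForm δ₀ k / h28 a k ≤ phiForm δ₀ l / h28 a l) -
          F (Finset.univ.filter fun l => phiForm δ₀ k / h28 a k < phiForm δ₀ l / h28 a l)) *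
        (phiForm δ k / h28 a k) -
      Λ * ∑ k, ∑ l, (if phiForm δ₀ k / h28 a k < phiForm δ₀ l / h28 a l then
        max (phiForm δ k / h28 a k - phiForm δ l / h28 a l) 0 else 0) ≤
      cuspSlope a T δ := by
  have h := greedy_sub_wallGauge_le_cuspSlope hpos hT hper hf hF (Λ := fun _ _ => Λ)
    (fun S k l hkS hlS hkl => hdef S k l hkS hlS hkl) hgen δ
  have e : ∑ k, ∑ l, (if phiForm δ₀ k / h28 a k < phiForm δ₀ l / h28 a l then
      (fun _ _ : Fin 28 => Λ) k l * max (phiForm δ k / h28 a k - phiForm δ l / h28 a l) 0 else 0) =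
      Λ * ∑ k, ∑ l, if phiForm δ₀ k / h28 a k < phiForm δ₀ l / h28 a l then
        max (phiForm δ k / h28 a k - phiForm δ l / h28 a l) 0 else 0 := by
    rw [Finset.mul_sum]
    refine Finset.sum_congr rfl fun k _ => ?_
    rw [Finset.mul_sum]
    refine Finset.sum_congr rfl fun l _ => ?_
    by_cases hkl : phiForm δ₀ k / h28 a k < phiForm δ₀ l / h28 a l
    · rw [if_pos hkl, if_pos hkl]
    · rw [if_neg hkl, if_neg hkl, mul_zero]
  linarith [e]

/-! ### Pointwise completeness: on the closed chamber the gauge vanishes -/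

/-- **The wall gauge vanishes on the closed chamber of the reference**: if `δ₀` refines `δ`
(`r_k(δ) < r_l(δ) ⇒ ρ₀ k < ρ₀ l`), no wall is inverted and
`Σ_{ρ₀ k < ρ₀ l} Λ k l · max(r_k(δ) − r_l(δ), 0) = 0` (any weights). -/
theorem wallGauge_eq_zero_of_refines (a : Dir) (Λ : Fin 28 → Fin 28 → ℝ) {δ₀ : Fin 8 → ℝ} {δ : Fin 8 → ℝ}
    (href : ∀ k l : Fin 28, phiForm δ k / h28 a k < phiForm δ l / h28 a l →
      phiForm δ₀ k / h28 a k < phiForm δ₀ l / h28 a l) :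
    ∑ k, ∑ l, (if phiForm δ₀ k / h28 a k < phiForm δ₀ l / h28 a l then
      Λ k l * max (phiForm δ k / h28 a k - phiForm δ l / h28 a l) 0 else (0 : ℝ)) = 0 := by
  have h := pairGauge_eq_zero_of_refines (ρ := fun k => phiForm δ₀ k / h28 a k) Λ
    (c := fun k => -(phiForm δ k / h28 a k)) fun k l hkl => href l k (by linarith)
  simp only [neg_sub_neg] at h
  exact h

/-- **POINTWISE COMPLETENESS OF THE WALL-WEIGHTED CERTIFICATE.** For every `δ` there is a generic reference `δ₀`
(one refining `δ`, P2 g30's cover) whose chamber functional predicts `σ(δ)` EXACTLY and whose wall gauge at `δ`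
vanishes for any weights: `σ(δ) = G_{δ₀}(δ)` and `Σ_{ρ₀ k < ρ₀ l} Λ k l · max(r_k(δ) − r_l(δ), 0) = 0`. So whenever
`σ(δ) ≤ 0`, SOME reference certifies it at `δ` with zero slack (file (3): finite cone certificates). -/
theorem exists_generic_wallBound_eq_cuspSlope {a : Dir} (hpos : ∀ k, 0 < h28 a k) {T : ℝ} (hT : 0 < T)
    (hper : ∀ k : Fin 28, ∃ z : ℤ, T * h28 a k = z)
    {M : ℕ → Finset (Fin 28)} {f : ℕ → Finset (Fin 28) → ℝ}
    (hf : ∀ m, m + 1 < (bkpts a T).card → ∀ Δ : Fin 8 → ℝ, (∀ k, |phiForm Δ k| < 1) →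
      (∀ k, |phiForm Δ k| < wallDist a T) →
        (torusN (bkpt a T m • sParam a + Δ) : ℝ) = f m ((M m).filter fun k => 0 ≤ phiForm Δ k))
    {F : Finset (Fin 28) → ℝ} (hF : ∀ A, F A = ∑ m ∈ Finset.range ((bkpts a T).card - 1), f m (A ∩ M m))
    (Λ : Fin 28 → Fin 28 → ℝ) (δ : Fin 8 → ℝ) :
    ∃ δ₀ : Fin 8 → ℝ, (∀ k l : Fin 28, k ≠ l → phiForm δ₀ k / h28 a k ≠ phiForm δ₀ l / h28 a l) ∧
      cuspSlope a T δ =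
        ∑ k, (F (Finset.univ.filter fun l => phiForm δ₀ k / h28 a k ≤ phiForm δ₀ l / h28 a l) -
            F (Finset.univ.filter fun l => phiForm δ₀ k / h28 a k < phiForm δ₀ l / h28 a l)) *
          (phiForm δ k / h28 a k) ∧
      ∑ k, ∑ l, (if phiForm δ₀ k / h28 a k < phiForm δ₀ l / h28 a l then
        Λ k l * max (phiForm δ k / h28 a k - phiForm δ l / h28 a l) 0 else (0 : ℝ)) = 0 := by
  obtain ⟨δ₀, hgen, href, hσ⟩ := exists_generic_greedy_eq_cuspSlope hpos hT hper hf hF δ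
  exact ⟨δ₀, hgen, hσ, wallGauge_eq_zero_of_refines a Λ href⟩

end Summit.KontsevichZagierPeriods.Zeta5Search.Barrier.ConeGamma

end
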